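import Literature.AnabelianGeometry.SemiGraphs.TemperedReconstructionR1Proofs
import Literature.AnabelianGeometry.SemiGraphs.TemperedVerticialNamedFactsProofs
import Literature.AnabelianGeometry.SemiGraphs.TemperoidsResProofs
import HarnessLib

/-!
# [SemiAnbd] Proposition 3.6 (iv) in the LITERAL currency `Hom.Induces` (print-coverage companion)

Mochizuki, *Semi-graphs of anabelioids*, Publ. RIMS **42** (2006), §3, Proposition 3.6 (iv),
manuscript p. 39 [cite: MochizukiSemiAnbd2006, Prop 3.6(iv) p.39]: "(iv) Any morphism of semi-graphs
of anabelioids `G' → G` induces a morphism of temperoids `B^temp(G') → B^temp(G)` [by pulling back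
tempered coverings of `G` to tempered coverings of `G'`].  Moreover, if the original morphism of
semi-graphs of anabelioids is locally open, then this morphism of temperoids is relatively temp-slim.
In particular, the temperoid `B^temp(G)` is temp-slim."

PROOF-ONLY companion (0 definitions) of the named fact `ProfiniteSemiGraph.InducedHomOfMorphism`
(`TemperedVerticial.lean`, abc-iut-L3-t2; DISCHARGED as typed by `inducedHomOfMorphism_holds`,
`TemperedVerticialNamedFactsProofs.lean`).  The typed fact renders sentence 1 "through charts" by a
homomorphism `φ : π₁^temp(G') → π₁^temp(G)` merely COMPATIBLE with the verticial homomorphisms, and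
sentence 2 for THAT `φ`.  Print's own currency — the one Corollary 3.9 consumes — is the pull-back
functor: `φ` *represents the induced morphism of temperoids* when `B^temp(φ) ≅ c_G⁻¹ ⋙ F^* ⋙ c_{G'}`
(`Hom.Induces`, `TemperedReconstruction.lean`; the functor `F^*` on tempered coverings IS a morphism of
temperoids: `Hom.temperoidHom` / `Hom.chartTemperoidHom`, `TemperedFunctorialityHomProofs.lean`).
This file records Proposition 3.6 (iv) sentence by sentence in that literal currency, knitting landed
theorems BY NAME (no new argument):

* `Hom.exists_induces` — sentence 1: a representative `φ` of the induced morphism EXISTS, for every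
  morphism `F` and all charts, with no hypothesis on the graphs (Proposition 3.2, surjectivity half,
  `TemperoidHomEqRes_holds`, applied to the morphism of temperoids `F.chartTemperoidHom c' c`);
* `Hom.induces_conj_of_induces` / `Hom.induces_of_conj` / `Hom.induces_iff_conj` — the induced
  morphism is an OUTER homomorphism: two representatives are conjugate, and every conjugate of a
  representative is one (Proposition 3.2, injectivity half, `ResIsoResIff_holds`; Remark 3.2.1);
* `Hom.compatV_of_induces` / `Hom.compatE_of_induces` — every representative is compatible, up to
  conjugation, with the verticial and the edge homomorphisms (the hypothesis-free body of step (R1)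
  `InducesCompatible_holds`, i.e. `Hom.conj_of_chartPullback_iso(_edge)`);
* `Hom.isRelativelyTempSlim_of_induces` — sentence 2 for EVERY representative `φ` of the induced
  morphism of a locally open `F` between graphs as in Proposition 3.6 (the reduction
  `InducedHomOfMorphism_clause2_of`, abc-iut-L3-t6, fed with `verticialHomRelativelyTempSlim_holds`);
* `inducedHomOfMorphism_induces` — the named fact with the literal conjunct `F.Induces c' c φ` ADDED
  (so the `φ` it produces is the induced outer homomorphism, not just a compatible one), and
  `isSlimGroup_chart` — sentence 3 ("in particular") re-exported next to it (`temperedPiSlim_holds`).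

HONEST FRAMING.  Statements of a refereed paper ([SemiAnbd]) about OUR typed objects; nothing here
bears on [IUTchIII] Cor. 3.12 and nothing asserts abc proved or refuted.  typed ≠ proved.
-/

namespace Literature.AnabelianGeometry.SemiGraphs

open Literature.AlgebraicGeometry.Frobenioids (IsSlimGroup)

namespace ProfiniteSemiGraph

universe u

variable {𝒢' 𝒢 : ProfiniteSemiGraph.{u}}

/-! ### Sentence 1: the induced morphism of temperoids, as an outer homomorphism through charts -/

/-- **[SemiAnbd] Prop. 3.6 (iv), sentence 1, literal** ("any morphism of semi-graphs of anabelioids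
`G' → G` induces a morphism of temperoids `B^temp(G') → B^temp(G)` [by pulling back tempered
coverings]"): for every morphism `F : G' → G` and all charts `c'`, `c` there is a continuous
`φ : π₁^temp(G') → π₁^temp(G)` REPRESENTING the induced morphism, i.e. with
`B^temp(φ) ≅ c⁻¹ ⋙ F^* ⋙ c'` (`F.Induces c' c φ`).  No hypothesis on `G'`, `G` beyond the existence
of the charts: Proposition 3.2 (surjectivity half) applied to the morphism of temperoids
`F.chartTemperoidHom c' c`. [cite: MochizukiSemiAnbd2006, Prop 3.6(iv) p.39] -/
theorem Hom.exists_induces (F : Hom 𝒢' 𝒢) (c' : TemperedPiChart 𝒢') (c : TemperedPiChart 𝒢) :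
    ∃ φ : c'.G →ₜ* c.G, F.Induces c' c φ := by
  haveI := c'.secondCountableTopology
  haveI := c.secondCountableTopology
  obtain ⟨φ, hφ⟩ :=
    TemperoidHomEqRes_holds c'.G c.G c'.isTempered c.isTempered (F.chartTemperoidHom c' c)
  exact ⟨φ, hφ⟩

/-- **Prop. 3.6 (iv) with Prop. 3.2 / Rmk. 3.2.1: the induced morphism is an OUTER homomorphism —
uniqueness**: two representatives `φ`, `ψ` of the morphism of temperoids induced by `F` are
conjugate in `π₁^temp(G)` (Proposition 3.2, injectivity half `ResIsoResIff_holds`).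
[cite: MochizukiSemiAnbd2006, Prop 3.6(iv) p.39] -/
theorem Hom.induces_conj_of_induces (F : Hom 𝒢' 𝒢) (c' : TemperedPiChart 𝒢') (c : TemperedPiChart 𝒢)
    {φ ψ : c'.G →ₜ* c.G} (hφ : F.Induces c' c φ) (hψ : F.Induces c' c ψ) :
    ∃ g : c.G, ∀ x, g * φ x * g⁻¹ = ψ x := by
  haveI := c'.secondCountableTopology
  haveI := c.secondCountableTopology
  obtain ⟨i⟩ := hφ
  obtain ⟨j⟩ := hψ
  exact (ResIsoResIff_holds c'.G c.G c'.isTempered c.isTempered φ ψ).1 ⟨i.symm ≪≫ j⟩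

/-- **… and closure under conjugation**: a conjugate `γ_g ∘ φ` of a representative `φ` of the induced
morphism again represents it (`B^temp(φ) ≅ B^temp(γ_g ∘ φ)`, the easy half of Proposition 3.2,
`BTemp.resIsoOfConj`). [cite: MochizukiSemiAnbd2006, Prop 3.6(iv) p.39] -/
theorem Hom.induces_of_conj (F : Hom 𝒢' 𝒢) (c' : TemperedPiChart 𝒢') (c : TemperedPiChart 𝒢)
    {φ ψ : c'.G →ₜ* c.G} (hφ : F.Induces c' c φ) (g : c.G) (hg : ∀ x, g * φ x * g⁻¹ = ψ x) :
    F.Induces c' c ψ := by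
  obtain ⟨i⟩ := hφ
  exact ⟨i ≪≫ BTemp.resIsoOfConj φ ψ g hg⟩

/-- **The induced outer homomorphism, characterised**: given one representative `φ`, a continuous
`ψ` represents the morphism of temperoids induced by `F` iff `ψ = γ_g ∘ φ` for some
`g ∈ π₁^temp(G)` ("the set of [continuous] outer homomorphisms", Prop. 3.2).
[cite: MochizukiSemiAnbd2006, Prop 3.6(iv) p.39] -/
theorem Hom.induces_iff_conj (F : Hom 𝒢' 𝒢) (c' : TemperedPiChart 𝒢') (c : TemperedPiChart 𝒢)
    {φ ψ : c'.G →ₜ* c.G} (hφ : F.Induces c' c φ) :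
    F.Induces c' c ψ ↔ ∃ g : c.G, ∀ x, g * φ x * g⁻¹ = ψ x :=
  ⟨fun hψ => F.induces_conj_of_induces c' c hφ hψ, fun ⟨g, hg⟩ => F.induces_of_conj c' c hφ g hg⟩

/-! ### Compatibility of every representative with the verticial and edge homomorphisms -/

/-- Every representative of the induced morphism is compatible, up to conjugation, with the verticial
homomorphisms (Prop. 3.6 (iv) / Thm. 3.7 (i); the hypothesis-free body of step (R1) of Cor. 3.9,
`Hom.conj_of_chartPullback_iso`). [cite: MochizukiSemiAnbd2006, Prop 3.6(iv) p.39] -/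
theorem Hom.compatV_of_induces (F : Hom 𝒢' 𝒢) (c' : TemperedPiChart 𝒢') (c : TemperedPiChart 𝒢)
    {φ : c'.G →ₜ* c.G} (hφ : F.Induces c' c φ) : F.CompatV c' c φ :=
  fun v' ψ' ψ hψ' hψ => F.conj_of_chartPullback_iso c' c φ hφ v' ψ' ψ hψ' hψ

/-- Every representative of the induced morphism is compatible, up to conjugation, with the edge
homomorphisms (Thm. 3.7 (iii) vocabulary; `Hom.conj_of_chartPullback_iso_edge`).
[cite: MochizukiSemiAnbd2006, Prop 3.6(iv) p.39] -/
theorem Hom.compatE_of_induces (F : Hom 𝒢' 𝒢) (c' : TemperedPiChart 𝒢') (c : TemperedPiChart 𝒢)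
    {φ : c'.G →ₜ* c.G} (hφ : F.Induces c' c φ) : F.CompatE c' c φ :=
  fun e' ψ' ψ hψ' hψ => F.conj_of_chartPullback_iso_edge c' c φ hφ e' ψ' ψ hψ' hψ

/-! ### Sentence 2: relative temp-slimness of THE induced morphism of a locally open morphism -/

/-- **[SemiAnbd] Prop. 3.6 (iv), sentence 2, literal** ("if the original morphism of semi-graphs of
anabelioids is locally open, then this morphism of temperoids is relatively temp-slim"): for `G'`, `G`
as in Proposition 3.6 and `F : G' → G` locally open, EVERY representative `φ` of the induced morphism of
temperoids is relatively temp-slim (abc-iut-L3-t6's reduction `InducedHomOfMorphism_clause2_of` fed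
with `verticialHomRelativelyTempSlim_holds` at `G'` and at `G` and with `compatV_of_induces`).
[cite: MochizukiSemiAnbd2006, Prop 3.6(iv) p.39] -/
theorem Hom.isRelativelyTempSlim_of_induces (h𝒢' : 𝒢'.Prop36Hypotheses) (h𝒢 : 𝒢.Prop36Hypotheses)
    (F : Hom 𝒢' 𝒢) (hF : F.IsLocallyOpen) (c' : TemperedPiChart 𝒢') (c : TemperedPiChart 𝒢)
    {φ : c'.G →ₜ* c.G} (hφ : F.Induces c' c φ) : IsRelativelyTempSlim φ :=
  InducedHomOfMorphism_clause2_of h𝒢' F hF c' c φ (F.compatV_of_induces c' c hφ)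
    (verticialHomRelativelyTempSlim_holds h𝒢' c') (verticialHomRelativelyTempSlim_holds h𝒢 c)

/-! ### The named fact in the literal currency, and sentence 3 -/

/-- **[SemiAnbd] Prop. 3.6 (iv) as typed (`InducedHomOfMorphism`), STRENGTHENED by the literal
conjunct**: for `G'`, `G` as in Proposition 3.6, every `F : G' → G` and all charts, there is a
continuous `φ : π₁^temp(G') → π₁^temp(G)` which REPRESENTS the induced morphism of temperoids
(`F.Induces c' c φ`), is compatible up to conjugation with the verticial and the edge homomorphisms,
and is relatively temp-slim when `F` is locally open.  (The typed fact asserts the last two properties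
of SOME `φ`; here that `φ` is the induced outer homomorphism itself.)
[cite: MochizukiSemiAnbd2006, Prop 3.6(iv) p.39] -/
theorem inducedHomOfMorphism_induces (h𝒢' : 𝒢'.Prop36Hypotheses) (h𝒢 : 𝒢.Prop36Hypotheses)
    (F : Hom 𝒢' 𝒢) (c' : TemperedPiChart 𝒢') (c : TemperedPiChart 𝒢) :
    ∃ φ : c'.G →ₜ* c.G, F.Induces c' c φ ∧ F.CompatV c' c φ ∧ F.CompatE c' c φ ∧
      (F.IsLocallyOpen → IsRelativelyTempSlim φ) := by
  obtain ⟨φ, hφ⟩ := F.exists_induces c' c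
  exact ⟨φ, hφ, F.compatV_of_induces c' c hφ, F.compatE_of_induces c' c hφ,
    fun hF => F.isRelativelyTempSlim_of_induces h𝒢' h𝒢 hF c' c hφ⟩

/-- Sentence 2 for ALL representatives at once: for `F` locally open between graphs as in Prop. 3.6,
the induced OUTER homomorphism is relatively temp-slim, whichever representative is chosen.
[cite: MochizukiSemiAnbd2006, Prop 3.6(iv) p.39] -/
theorem inducedHomOfMorphism_forall_induces (h𝒢' : 𝒢'.Prop36Hypotheses) (h𝒢 : 𝒢.Prop36Hypotheses)
    (F : Hom 𝒢' 𝒢) (hF : F.IsLocallyOpen) (c' : TemperedPiChart 𝒢') (c : TemperedPiChart 𝒢) :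
    (∃ φ : c'.G →ₜ* c.G, F.Induces c' c φ) ∧
      ∀ φ : c'.G →ₜ* c.G, F.Induces c' c φ → IsRelativelyTempSlim φ :=
  ⟨F.exists_induces c' c, fun _ hφ => F.isRelativelyTempSlim_of_induces h𝒢' h𝒢 hF c' c hφ⟩

/-- **[SemiAnbd] Prop. 3.6 (iv), sentence 3** ("In particular, the temperoid `B^temp(G)` is
temp-slim"), at a chart: `π₁^temp(G)` is a slim group — the named fact `TemperedPiSlim`
(`temperedPiSlim_holds`) instantiated, recorded next to sentences 1–2 for print coverage.
[cite: MochizukiSemiAnbd2006, Prop 3.6(iv) p.39] -/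
theorem isSlimGroup_chart (h𝒢 : 𝒢.Prop36Hypotheses) (c : TemperedPiChart 𝒢) : IsSlimGroup c.G :=
  temperedPiSlim_holds 𝒢 h𝒢 c

end ProfiniteSemiGraph

end Literature.AnabelianGeometry.SemiGraphs
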